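import Summits.SmoothPoincare4.SmoothPoincare4.Theses.EntropyRung
import Summits.SmoothPoincare4.SmoothPoincare4.Theorems.SubcylindricalExistence.Negative.Window
import Summits.SmoothPoincare4.SmoothPoincare4.Theorems.EntropyRungSubcylindricalExistenceFloorBridge
import Summits.SmoothPoincare4.SmoothPoincare4.Theorems.EntropyRungSubcylindricalExistenceConeCapping
import Summits.SmoothPoincare4.SmoothPoincare4.Theorems.EntropyRungSubcylindricalExistenceScalarPositiveUpgrade
import Literature.Geometry.Riemannian.SharpLogSobolevAVR
import HarnessLib

/-!
# `EntropyRung.SubcylindricalExistence` from a conformal fat cone core — the reduction of line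
# `fat-conical-core-avr-logsobolev` (crux stmt-SmoothPoincare4-10871) as an importable theorem

The line's composition, moved from the crux workfile
`Cruxes/SubcylindricalExistence/Lines/fat_conical_core_avr_logsobolev.lean` into the tree: the crux
`SubcylindricalExistence` (ENT: every closed smooth homotopy 4-sphere carries `R > 0` with
`ν > ν_cyl = log Θ(S³×ℝ)`) follows from
* the sharp AVR log-Sobolev inequality (Balogh–Kristály–Tripaldi 2024, Thm 1.1; the Literature named
  fact `Literature.Geometry.Riemannian.sharpLogSobolevAVR_four` — UNPROVED in the tree, so this theorem
  is CONDITIONAL on it), and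
* the TRANSFER statement `ConeCoreExistence` (stub T of the line, its SPC4-hard bet, stated here as the
  second hypothesis verbatim): every closed smooth homotopy 4-sphere `M` carries a metric `g` Euclidean in
  the chart at some `p`, a cone factor `Λ = c ρ^{−(c+1)}` there with `c³ > Θ(S³×ℝ) = 2√π e^{−3/2}`,
  `0 < c ≤ 1`, and a complete `Ric ≥ 0` core `(P, h) ≅ ({p}ᶜ, Λ²g)` of asymptotic volume ratio `c³`,
through the three LANDED stubs of the line: the floor bridge `stub_floorBridge` (BKT on the core ⇒ the
floor `3 log c` on `M` and `R_g Λ − 6 Δ_g Λ ≥ 0` off `p`), the conformal capping `stub_coneCapping`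
(clause at `min (3 log c) (log 6 − 2) − ε`, `R_G ≥ 0`, `R_G(p) > 0`) and the upgrade
`stub_scalarPositiveUpgrade` (`R > 0` at cost `ε`), with `ε = (min (3 log c) (log 6 − 2) − ν_cyl)/3 > 0`
(`cap_margin`: `3 log c > ν_cyl` is the threshold on `c`, `log 6 − 2 > ν_cyl` is
`Negative.nuCyl_lt_nuRound`).
-/

noncomputable section

open scoped Manifold ContDiff Topology ENNReal NNReal ContinuousMap RealInnerProductSpace
set_option linter.dupNamespace false
open Set Filter Function MeasureTheory
open Literature.Geometry.Lorentzian Literature.Geometry.Riemannian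

namespace Summit.SmoothPoincare4.SmoothPoincare4.Theorems

namespace ConeCoreReduction

/-- The slope threshold: `c³ > Θ(S³×ℝ) = 2√π e^{−3/2}` is `3 log c > ν_cyl`. -/
theorem log_threshold {c : ℝ} (h : 2 * Real.sqrt Real.pi * Real.exp (-(3 : ℝ) / 2) < c ^ 3) :
    Real.log 2 + Real.log Real.pi / 2 - 3 / 2 < 3 * Real.log c := by
  have hpos : 0 < 2 * Real.sqrt Real.pi * Real.exp (-(3 : ℝ) / 2) := by positivity
  have hlog := Real.log_lt_log hpos h
  have hsqrt : Real.log (Real.sqrt Real.pi) = Real.log Real.pi / 2 := by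
    rw [Real.sqrt_eq_rpow, Real.log_rpow Real.pi_pos]; ring
  rw [Real.log_mul (by positivity) (Real.exp_pos _).ne', Real.log_mul (by norm_num) (by positivity),
    Real.log_exp, hsqrt, Real.log_pow] at hlog
  push_cast at hlog
  linarith

/-- The cap's margin is the route's window: `min (3 log c) (log 6 − 2) > ν_cyl`. -/
theorem cap_margin {c : ℝ} (h : 2 * Real.sqrt Real.pi * Real.exp (-(3 : ℝ) / 2) < c ^ 3) :
    Real.log 2 + Real.log Real.pi / 2 - 3 / 2 < min (3 * Real.log c) (Real.log 6 - 2) :=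
  lt_min (log_threshold h) Summit.SmoothPoincare4.Cruxes.SubcylindricalExistence.Negative.nuCyl_lt_nuRound

end ConeCoreReduction

/-- **The reduction of line `fat-conical-core-avr-logsobolev`**: the sharp AVR log-Sobolev inequality
(Literature named fact, hypothesis) and the transfer statement `ConeCoreExistence` (stub T, hypothesis,
verbatim) imply the crux `EntropyRung.SubcylindricalExistence` — through the landed `stub_floorBridge`,
`stub_coneCapping`, `stub_scalarPositiveUpgrade`. For `M ≃ₕ S⁴`: T gives `(g, p, r, Λ, c, P, h, ι, σ)`;
the bridge turns BKT on the core into the floor `3 log c` on `M` and `R_g Λ − 6Δ_g Λ ≥ 0` off `p`;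
capping closes it inside `M` at level `min (3 log c) (log 6 − 2) − ε`; the upgrade makes `R > 0` at level
`min − 2ε`; with `ε = (min − ν_cyl)/3` this is ENT for `M` with `δ = ε`. -/
theorem helper_subcylindricalExistence_of_coneCore :
    Literature.Geometry.Riemannian.sharpLogSobolevAVR_four →
    (∀ (M : Type) [TopologicalSpace M] [T2Space M] [SecondCountableTopology M]
      [ChartedSpace (EuclideanSpace ℝ (Fin 4)) M] [IsManifold (𝓡 4) ∞ M] [CompactSpace M]
      [T3Space M] [MeasurableSpace M] [BorelSpace M],
      M ≃ₕ Metric.sphere (0 : EuclideanSpace ℝ (Fin 5)) 1 →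
      ∃ g : PseudoRiemannianMetric (𝓡 4) ∞ (EuclideanSpace ℝ (Fin 4)) (TangentSpace (𝓡 4) : M → Type _),
      ∃ _ : g.HasLeviCivita, ∃ _ : g.IsRiemannian, ∃ (p : M) (r : ℝ) (Λ : M → ℝ) (c : ℝ)
        (P : Type) (_ : TopologicalSpace P) (_ : T2Space P) (_ : SecondCountableTopology P)
        (_ : ChartedSpace (EuclideanSpace ℝ (Fin 4)) P) (_ : IsManifold (𝓡 4) ∞ P) (_ : ConnectedSpace P)
        (_ : NoncompactSpace P) (_ : T3Space P) (_ : MeasurableSpace P) (_ : BorelSpace P)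
        (h : PseudoRiemannianMetric (𝓡 4) ∞ (EuclideanSpace ℝ (Fin 4)) (TangentSpace (𝓡 4) : P → Type _))
        (_ : h.HasLeviCivita) (hh : h.IsRiemannian) (ι : P → M) (σ : M → P),
        (Metric.closedBall (extChartAt (𝓡 4) p p) r ⊆ (extChartAt (𝓡 4) p).target ∧
          ∀ y ∈ Metric.closedBall (extChartAt (𝓡 4) p p) r, ∀ X W : EuclideanSpace ℝ (Fin 4),
            g.val ((extChartAt (𝓡 4) p).symm y)
              (mfderiv 𝓘(ℝ, EuclideanSpace ℝ (Fin 4)) (𝓡 4) (extChartAt (𝓡 4) p).symm y X)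
              (mfderiv 𝓘(ℝ, EuclideanSpace ℝ (Fin 4)) (𝓡 4) (extChartAt (𝓡 4) p).symm y W) = ⟪X, W⟫) ∧
        (ContMDiffOn (𝓡 4) 𝓘(ℝ, ℝ) ∞ Λ {p}ᶜ ∧ (∀ x, x ≠ p → 0 < Λ x) ∧
          ∀ y ∈ Metric.closedBall (extChartAt (𝓡 4) p p) r, y ≠ extChartAt (𝓡 4) p p →
            Λ ((extChartAt (𝓡 4) p).symm y) = c * ‖y - extChartAt (𝓡 4) p p‖ ^ (-(c + 1))) ∧
        (ContMDiff (𝓡 4) (𝓡 4) ∞ ι ∧ Injective ι ∧ (∀ q : P, Injective (mfderiv (𝓡 4) (𝓡 4) ι q)) ∧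
          range ι = {p}ᶜ ∧ ContMDiffOn (𝓡 4) (𝓡 4) ∞ σ {p}ᶜ ∧ (∀ q : P, σ (ι q) = q) ∧
          (∀ x : M, x ≠ p → ι (σ x) = x) ∧
          ∀ (q : P) (v w : TangentSpace (𝓡 4) q),
            h.val q v w = Λ (ι q) ^ 2 *
              g.val (ι q) (mfderiv (𝓡 4) (𝓡 4) ι q v) (mfderiv (𝓡 4) (𝓡 4) ι q w)) ∧
        ((∀ (x : P) (r : NNReal), IsCompact {y : P | h.edist hh x y ≤ r}) ∧
          (∀ (x : P) (X : TangentSpace (𝓡 4) x), 0 ≤ h.ricci x X X) ∧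
          ∀ x : P, Tendsto (fun r : ℝ ↦
            ((riemannianMeasure (h.toContMDiffRiemannianMetric hh))
              {y : P | h.edist hh x y ≤ ENNReal.ofReal r}).toReal / (Real.pi ^ 2 / 2 * r ^ 4))
            atTop (𝓝 (c ^ 3))) ∧
        (0 < r ∧ 0 < c ∧ c ≤ 1) ∧ 2 * Real.sqrt Real.pi * Real.exp (-(3 : ℝ) / 2) < c ^ 3) →
    Summit.SmoothPoincare4.SmoothPoincare4.Theses.EntropyRung.SubcylindricalExistence := by
  intro hBKT hCore M _ _ _ _ _ _ _ _ _ e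
  -- `M ≃ₕ S⁴` is connected: `S⁴` is path connected and path components are homotopy invariants
  haveI : PathConnectedSpace (Metric.sphere (0 : EuclideanSpace ℝ (Fin 5)) 1) := by
    refine isPathConnected_iff_pathConnectedSpace.mp (isPathConnected_sphere ?_ 0 zero_le_one)
    rw [← Module.finrank_eq_rank, finrank_euclideanSpace_fin]
    exact Nat.one_lt_cast.mpr (by norm_num)
  haveI : PathConnectedSpace M :=
    Literature.Topology.FourManifolds.pathConnectedSpace_of_homotopyEquiv e
  obtain ⟨g, _, hg, p, r, Λ, c, P, _, _, _, _, _, _, _, _, _, _, h, _, hh, ι, σ, hflat, hcone, hlink,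
    hgeom, ⟨hr, hc, hc1⟩, hc3⟩ := hCore M e
  -- the floor on `M` and `R_g Λ − 6 Δ_g Λ ≥ 0` off `p`, from BKT on the core
  obtain ⟨hfloor, hRΛ⟩ := stub_floorBridge hBKT M g hg p Λ c P h hh ι σ hcone.1 hcone.2.1 hc hlink hgeom
  -- the margin
  set ν₀ : ℝ := Real.log 2 + Real.log Real.pi / 2 - 3 / 2 with hν₀
  set m : ℝ := min (3 * Real.log c) (Real.log 6 - 2) with hm
  have hmar : ν₀ < m := ConeCoreReduction.cap_margin hc3
  set ε : ℝ := (m - ν₀) / 3 with hε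
  have hεpos : 0 < ε := by rw [hε]; linarith
  -- cap inside `M`, then make the scalar curvature positive
  obtain ⟨G, _, hG, hR0, hRpos, hν⟩ :=
    stub_coneCapping hBKT M g hg p r Λ c hflat hcone hr hc hc1 hRΛ hfloor ε hεpos
  obtain ⟨G', hLC', hG', hR', hν'⟩ := stub_scalarPositiveUpgrade M G hG (m - ε) hR0 hRpos hν ε hεpos
  refine ⟨G', hLC', hG', hR', ε, hεpos, fun τ hτ f hf hnorm ↦ ?_⟩
  have h1 := hν' τ hτ f hf hnorm
  have h2 : ν₀ + ε = m - ε - ε := by rw [hε]; ring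
  rw [h2]
  exact h1

end Summit.SmoothPoincare4.SmoothPoincare4.Theorems

end
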